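import Summits.BirchSwinnertonDyer.Rank1Residual.F1Sign2.TwoTorsionPlanesAtTwo
import Summits.BirchSwinnertonDyer.Rank1Residual.F1Sign2.DescentSignAtTwo
import HarnessLib.Audit.Tags
import HarnessLib

/-!
# Cell `bsd-f1-sign2` — IMC lens (-imc g17, planner-of-record; MEMO-imc §10.96-add3/add4/add5/add6; D-imc-53): IMC-WP53 file 4 —
# THE TWO-SELMER TRANSFER LAWS along a same-level odd-Tamagawa `2`-congruence: P53s, P53s₀, P53s♭, P53s≤ and the
# archimedean-line laws P53↻ / P53½ / P53∞

STATEMENTS ONLY, typer -ty g17.  Source: `HOME/MEMO-imc-data/dimc53/lean/Sketch53.lean` = v9 **564542c441264358** (705 l., 17 Props rc 0,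
BC7 `Probe53v9` 17/17 CLEAN; REF1's copy `HOME/REF1-data/b183/Sketch53_v9_564542.lean`), blocks l.464–572 (P53s `TwoSelmerRankTransferLawAtTwo`, P53s₀
`TwoSelmerCompanionLawAtTwo`, P53s♭ `TwoSelmerRankTransferLawFlatAtTwo`, P53s≤ `TwoSelmerTransferBoundAtTwo`) and l.583–651 (the §10.96-add5 «archimedean line»
block: P53↻ `TwoSelmerCycleOrientationLawAtTwo`, P53½ `TwoSelmerInnerSwapLawAtTwo`, P53∞ `RealIdentityComponentLawAtTwo`) VERBATIM — decl bodies byte-identical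
(builder-verified against the sketch AND against REF1's `Probe183v9.lean` d6410ed65f556a67), docstrings = -imc's text verbatim with -imc's free-form trailing bracket
tag rewritten in parentheses (it mixes «conjecture:» with cite keys; the keys are re-issued as proper cite tags in the REF2 rider) + one REF1-AUDIT §183 and one
REF2-PLACEMENT v48 §9 / v49 §2 rider per row.  Continues `F1Sign2/HalfPeriodWeilPairingAtTwo.lean` (vocabulary, S53, P53a/b/c/r), `F1Sign2/TwoTorsionPlanesAtTwo.lean`
(P53m, `MapsConnectedTwoTorsionRootAtTwo`, P53f, and the supports P53i′/P53o′ already filed there by -ty g16) — both imported — and uses -desc's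
`selmerTwoCard W := Nat.card (W.selmerGroup 2)` (`F1Sign2/DescentSignAtTwo.lean`; v9's extra import).  The PROVED bookkeeping of v9 (`dvd_two_mul_of_eq_or_double`,
`le_of_isLeast_of_mem`), REF1's §183 kernel certificates T183b–h and glue C183a/C183b, and the typer's discharge of REF1 R183f (`exists_isLeast_isGreatest`, making
C183a/C183b unconditional) are in the sibling `F1Sign2/TwoSelmerTransferLawAtTwoKernel.lean` (theorems only).  All seven rows keep -imc's `@[conjecture]` attribute
(REF1 §183: «port … as `@[conjecture]` rows VERBATIM»; theorem-grade print-assembly mod L53 is a GRADE, recorded in the riders, not an assertion).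
NOT FILED: D-53-L `LocalKummerAgreementAtTwo W W' g` (a sketch row for -imc — it needs `g ↦ β_g : W[2] ≅ W'[2]` as an equivariant map of `geomTorsion … 2`, which the tree
lacks; REF2 v49 §2.5 (3): after O-ss its off-Kilford meaning is a theorem-shape, on the Kilford stratum it is «β flat» = `MapsConnectedTwoTorsionRootAtTwo`); REF1's
suggestion to make P53s(b) ORIENTED (merge P53↻ into P53s♭) is -imc's call — v9 is ported as sketched, the orientation lives in P53↻.
THE LOCAL AGREEMENT LEMMA L53 (status per REF1 §183 (i) + REF2 v49 §2.1/§2.2/§2.2′): odd `v ∤ 2N` and odd `v ∣ N` with `c_v` odd — IN PRINT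
([cite: Cesnavicius2016SelmerFlat, Thm. 1.1, Prop. 2.5] «if deg φ is prime to c_A c_B then im(B(k)/φA(k)) = H¹_fppf(O, 𝒜[φ])», «char k ∤ deg φ ⟹ H¹_fppf = H¹_nr»;
[cite: PoonenRains2012, Prop. 4.12]; additive Tam-odd odd primes carry NO local condition at all: `H¹(ℚ_v, E[2]) = 0`); `v = 2` good ORDINARY — elementary from print
given β flat (REF2 (E1): `Ext¹_{ℤ₂}(ℤ/2, μ₂) = ℤ₂^×/□ ↪ ℚ₂^×/□` pins `𝓔[2]` from `(V, connected line)`, so «β flat ⟺ MapsConnected»); `v = 2` good SUPERSINGULAR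
(-imc's «residual crux L53(ss)», 22 158 pairs) — **IN PRINT VERBATIM** (REF2 v49 §2.2′): [cite: Cesnavicius2016SelmerFlat, Example (2-ss-eg) (arXiv p0009 L5–9)] «A[2]_{K_v^sh} is
irreducible and an 𝔽₄-vector space scheme of dimension 1; by [Ray74, 3.3.2 3°] 𝒜[2]_{O_v^sh} is its unique finite flat model … fpqc descent» = [cite: Raynaud1974, Prop. 3.3.2 (3°)]
+ [cite: Serre1972PointsOrdreFini, §1.11 Prop. 12] (REF2 O-ss re-derived it from Tate CSS97 Thm. 4.4.1(c): at (p,e) = (2,1) the only ambiguity among Raynaud 𝔽₄-schemes is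
type (0,0) ↔ (1,1), the local-local types have a UNIQUE prolongation; -ty cites the Example, not Tate 4.5.1).  Hence (REF1 §183 grade + REF2 v49 §2.2 consequence) the
P53 family P53s(a)(b) / P53s₀ / P53s♭ (flat stratum) / P53↻ / P53½ / P53∞ is ONE PRINT-ASSEMBLY THEOREM-SKETCH with no open lemma — the cell's cleanest «provable
now, not printed» candidate; the STATEMENTS are not in print ([cite: MazurRubin2015SelmerCompanions, Thm. 3.1] is VOID at `p = 2` with good reduction at 2 by its own
hypothesis «e(𝔭/p) < p − 1»; [cite: GreenMaistret2022, Thm. 2.4, Thm. 2.11, Thm. 1.3] transfers only the 2^∞-Selmer PARITY).  Beyond-print theorem: no.  PARTITION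
none (Selmer-transport laws; no BSD case moves).  BSD is not proved.  bears_on: stmt-BirchSwinnertonDyer-23715.
-/

set_option autoImplicit false

noncomputable section

open scoped Classical MatrixGroups ModularForm

open CongruenceSubgroup WeierstrassCurve Literature.NumberTheory.EllipticCurves
  Literature.NumberTheory.EllipticCurves.ModularForms Literature.NumberTheory.EllipticCurves.Sprung2017

namespace Summit.BirchSwinnertonDyer.Rank1Residual.F1Sign2


/-! ### P53s family (§10.96-add3/add4): exact transfer, companion half, flat form, bound -/

/-- **P53s — EXACT TWO-SELMER RANK TRANSFER LAW along a same-level odd-Tamagawa `2`-congruence (v5; the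
common sharpening of P53i and P53o from root numbers to `#Sel₂`).**  Same odd `N`, both curves modular of
level `N` (`IsNewformOf`), `E[2] ≅ E'[2]` irreducible with image `S₃` (`¬ IsSquare Δ`), all Tamagawa numbers
of both curves odd, `W` off the Kilford stratum; `g` the (unique) Galois bijection on `2`-division roots,
`x₁ ≤ x₃` the least / greatest real roots of `ψ_W` (equal iff `Δ_W < 0`).  THEN
(a) if `g` keeps the orientation of the outer real roots (`g x₁ ≤ g x₃`; automatic for `Δ < 0`; for `Δ > 0`
    the classes `id`, `(e₂e₃)`, `(e₁e₂)` of `β`) the `2`-Selmer groups have the SAME order;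
(b) if `g` reverses it (`β ∈ {(e₁e₃), 3-cycles}`) they differ by EXACTLY a factor `2`.
MECHANISM (memo §10.96-add3): the local Kummer conditions of `E` and `E'` in `H¹(ℚ_v, E[2])` COINCIDE at
every finite place (good `v ≠ 2`: unramified classes; `v ∣ N` with `c_v` odd: `E(ℚ_v)/2 = E⁰(ℚ_v)/2` has
unramified Kummer image `H¹_ur`, a function of `E[2]|_{D_v}` — same level forces the same reduction type;
`v = 2` off the Kilford stratum: the finite flat model of `E[2]|_{D₂}` is unique (ordinary non-split:
`μ₂`-by-étale with injective `H¹_fl → H¹`; supersingular: local-local), so `H¹_fl(ℤ₂, 𝓔[2]) = H¹_fl(ℤ₂, 𝓔'[2])`),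
and at `∞` they are the lines `⟨T♮_E⟩ = ⟨(e₁,0)⟩`, `⟨β T♮_{E'}⟩` (`0` for `Δ < 0`).  Hence `Sel₂(E) = Sel₂(E')`
inside `H¹(ℚ, E[2])` when `β` fixes `e₁`, and `|s₂(E) − s₂(E')| ≤ 1` otherwise; the residual parity is the
theta-discrepancy law (`ThetaDiscrepancyParityAtTwo`, -desc §20; Green–Maistret 2022): the archimedean
Poonen–Rains form has zero set `{0, (e₁,0), (e₃,0)}` (the OUTER roots: `(x(P)−e)(x(P+T_e)−e) = (e−e')(e−e'')`
is positive iff `e` is an outer root), so `u_∞ = 0, (e₁,0), (e₃,0)` according as `β` fixes `e₂`, fixes `e₁`,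
fixes `e₃`, and the reduced-space parity lemma gives `s₂(E) − s₂(E') ≡ [β reverses the outer roots]` —
in particular `0` for the egg-swap `(e₁e₂)` although the local conditions at `∞` differ there.
CENSUS (BC5; three engines for `β`, `(rank, #Ш_an)` from Cremona's `allbsd` with `#Ш_an ∈ {odd, 4}` so that
`dim Ш[2]` is unambiguous, Cassels–Tate + Monsky for `s₂ = rank + dim Ш[2]`): ALL same-level congruent optimal
pairs with `N < 5·10⁵`: (a) `Δ<0` 18092/18092, `id` 4063/4063, `(e₂e₃)` 1848/1848, `(e₁e₂)` 1431/1431;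
(b) `(e₁e₃)` 6057/6057, 3-cycles 3994/3994 — 35 485 pairs, 0 exceptions; 2884 of the (a)-pairs have
different Mordell–Weil ranks (`(0, Ш ⊇ (ℤ/2)²) ~ (2, ·)`: 2665, e.g. 571a1 ~ 571b1 = Cremona–Mazur's first
visible `Ш`; `(1, Ш ⊇ (ℤ/2)²) ~ (3, ·)`: 219); 796 further pairs with `#Ш_an ∈ {16, 64, …}` are consistent
and turned into PREDICTIONS of the `Ш` structure (`dim Ш[2] = 2`, e.g. `#Ш_an = 16 ⇒ Ш[2^∞] ≅ (ℤ/4)²`), CONFIRMED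
796/796 by PARI `ellrank` (kit j327669; 328 curves: `#Ш_an = 16`: 274, `36`: 29, `64`: 17, `100`: 5, `144, 196, 784`: 1 each;
the same job re-derives `s₂` on 605/605 sampled unambiguous curves — third engine).  Boundary: Tam-even and Kilford pairs violate (a)/(b) at coin-flip rates (§10.96-add2).
WHY NOVEL: Mazur–Rubin's `2`-Selmer companions need `E[4] ≅ E'[4]`; Green–Maistret / Dokchitser–Maistret and
-desc §20 transfer only the PARITY; Cremona–Mazur–Agashe–Stein visibility gives one inclusion at odd `p`.  Here
`E[2]` alone, in the same-level odd-Tamagawa off-Kilford regime, transfers the exact `2`-Selmer rank up to a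
signed archimedean unit read off the real `2`-torsion — the algebraic face of the mod-2 modular-symbol transport
P53b.  Why it might fail: a finite place where the Kummer conditions of a Tam-odd same-level pair differ after
all (additive potentially-good primes with `E[2]^{I_v} ≠ 0`; the flat-uniqueness claim at `2` for ordinary
non-split `E[2]|_{D₂}`), which would allow `|s₂(E) − s₂(E')| = 2`.
(-imc's tag — conjecture: MEMO-imc §10.96-add3; refs MazurRubin2015SelmerCompanions Thm. 3.1, GreenMaistret2022 Thm. 1.3,
CremonaMazur2000 §3 (571A), PoonenRains2012 §4 — keyed as cite tags in the REF2 rider below.)  (`Irreducible ψ_{W'}` is load-bearing: without it the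
constant carrier `g = C c` makes the law a blanket claim, REF1-AUDIT §181.)
REF1-AUDIT §183 (register 3acd110ceeeb0fe0; evidence `HOME/REF1-data/b183/`): **SURVIVES — theorem-grade PRINT-ASSEMBLY modulo the local agreement lemma L53** (file
header): with step (iv) «`q_∞` vanishes exactly on the OUTER roots, `q_∞(T_i) = [(e_i − e_j)(e_i − e_k) < 0]`» now PROVED by REF1 (two derivations — period–index conic
`(e₃−e₂)s₁X² − (e₃−e₁)s₂Y² + (e₂−e₁)s₃Z²` of the class `𝒪(2O)` on the 2-covering `x − e_i = s_i u_i²`, and twist-invariance of the Heisenberg extension of `𝒪(2O)`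
(Mumford `e_*^𝓛 ≡ 1`) ⟹ the Kummer lines `⟨T₁⟩` of `E` and `⟨T₃⟩` of `E^(−1)` are both isotropic; kernel table `prForm_zero_set_eq_outer_roots` + the `𝔽₂²` lemma
`anisotropic_sum_of_isotropic`, Kernel file), (ii) also from the Greenberg–Wiles product formula (the factor 2 is the place 2), (iii) needing NO compatibility between
`q_∞(E)` and `q_∞(E′)`, and (v) re-derived, **P53s(a)(b) / P53s♭ / P53↻ / P53½ / P53∞ are ONE theorem mod L53**; rider R183a: clause (b)'s disjunction is ORIENTED (=
P53↻ below — the direction of the jump is decided by the cycle's orientation; for `(e₁e₃)` by the archimedean line, not by root data); `¬ IsSquare W.Δ` is redundant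
(R183d: a `C₃`-image curve of odd conductor is ordinary-Kilford; supersingular at 2 ⟹ local image `S₃`, 94/94 to `1.3·10⁵`); the §181 junk constant carrier is
EXCLUDED by `Irreducible ψ_{W'}` (`not_carriesTwoTorsion_C_of_irreducible`, `F1Sign2/HalfPeriodWeilPairingAtTwoKernel.lean`) and a carrier maps real roots to real roots
(`evalReal_mem_realTwoTorsionRoots_of_carries`, Kernel file), clauses (a)/(b) exhaustive & exclusive, (b) void for `Δ < 0`, the diagonal `(W, W, X)` consistent
(T183c–f); **THIRD ENGINE** (REF1, pure python from Cremona `allbsd`/`allgens`, ALL isogeny-class members, exact carriers `g ∈ ℚ[X]` by continued-fraction recognition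
+ exact divisibility check, odd `N < 5·10⁴`: 52 957 congruent `S₃` pairs, 8 179 framed): **P53s 7 202/7 202**, REGIME × PERM × `Δs₂` table in the register (off-Kilford
`Δ<0` 3 628×0, `id` 746×0, `(e₂e₃)` 457×0, `(e₁e₂)` 321×0, `(e₁e₃)` −1: 562 / +1: 548, cycle `e₁↦e₂′` −1: 502/502, inverse +1: 438/438); hypothesis mutation: dropping
`Odd W.tamagawaProduct` kills the law at once (41 108 Tam-even cross-class pairs); R183c: the laws force `Ш[2^∞] ≅ (ℤ/4)²` on 22 named rank-0 `#Ш_an = 16` curves (data ask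
A-183).  REF2-PLACEMENT v48 §9.1 (f0b2b1638913f337) + v49 §2 (3e15b9790477006f / 8f6d1c3372e3358c): **PRINT-ASSEMBLY, theorem-grade (≈ 15 lines), NOT verbatim in print as a
statement; beyond-print theorem: no** — = v48 §3.6 P1 (`Δ < 0`: dims equal) and P2 (`Δ > 0`: `|Δ dim| ≤ 1`, `= 0 ⟺ π(1) < π(3)`) derived BEFORE the census; inputs
[cite: Cesnavicius2016SelmerFlat, Thm. 1.1, Prop. 2.5, Example (2-ss-eg)] (local agreement at odd `v` under odd Tamagawa numbers; the flat model at supersingular 2 is unique =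
[cite: Raynaud1974, Prop. 3.3.2 (3°)]), REF2 (E1) at ordinary 2, [cite: PoonenRains2012, Prop. 4.10, Prop. 4.12, Thm. 4.13(a)] (Kummer images maximal isotropic at every place,
reciprocity), [cite: MazurRubin2010, Lemma 3.2] (`dim S^T − dim S_T = Σ_{v∈T} dim H¹_f(K_v, E[2])`, `T = {∞}`), [cite: Monsky1996, Thm. 1.5] (2-parity);
[cite: GreenMaistret2022, Thm. 2.4, Thm. 2.11, Lemma 6.3] controls the 2^∞-Selmer PARITY only and gives the normal form `(E, (Jac E′)^(d))`, `E′ : y² = x f(x)` of every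
P53 pair — P53s is beyond GM22 alone, NOT beyond print-assembly; [cite: MazurRubin2015SelmerCompanions, Thm. 3.1] (companions need `E[4] ≅ E′[4]` and exclude good
reduction above 2 at `p = 2`, «e(𝔭/p) < p − 1») is the printed neighbour that stops where P53s starts — cited as contrast, not support; [cite: CremonaMazur2000, §3] (571a1 ~
571b1, the first visible `Ш`, is the rank-jumping class `π(1) > π(3)`).  PARTITION none; BSD not proved. -/
@[conjecture] def TwoSelmerRankTransferLawAtTwo : Prop :=
  ∀ {N : ℕ} [NeZero N] (W W' : WeierstrassCurve ℚ) (f f' : CuspForm (Gamma0 N) 2),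
    Odd N → W.IsElliptic → W'.IsElliptic → IsNewformOf W f → IsNewformOf W' f' →
    Irreducible W.twoTorsionPolynomial.toPoly → Irreducible W'.twoTorsionPolynomial.toPoly →
    ¬ IsSquare W.Δ → ¬ TwoTorsionSplitAtTwo W →
    Odd W.tamagawaProduct → Odd W'.tamagawaProduct →
    ∀ g : Polynomial ℚ, CarriesTwoTorsion W W' g →
    ∀ x₁ x₃ : ℝ, IsLeastTwoTorsionRoot W x₁ → IsGreatestTwoTorsionRoot W x₃ →
      (evalReal g x₁ ≤ evalReal g x₃ → selmerTwoCard W = selmerTwoCard W') ∧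
      (evalReal g x₃ < evalReal g x₁ →
        selmerTwoCard W' = 2 * selmerTwoCard W ∨ selmerTwoCard W = 2 * selmerTwoCard W')

/-- **P53s₀ — the COMPANION HALF alone (theorem-candidate: no theta groups needed).**  Under the hypotheses of
P53s, if `g` maps the least real root of `ψ_W` to the least real root of `ψ_{W'}` (automatic for `Δ < 0`;
`β ∈ {id, (e₂e₃)}` for `Δ > 0`) then ALL local Kummer conditions agree and `Sel₂(E) = Sel₂(E')` inside
`H¹(ℚ, E[2])`; recorded as equality of orders.  Census `N < 5·10⁵`: 24 003/24 003 (`Δ<0` 18092, `id` 4063,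
`(e₂e₃)` 1848).  Why it might fail: as P53s (a finite place of disagreement).
(-imc's tag — conjecture: MEMO-imc §10.96-add3; ref MazurRubin2015SelmerCompanions Thm. 3.1 — keyed in the REF2 rider below.)
REF1-AUDIT §183: **SURVIVES as a COROLLARY of P53s** (glue C183a `companionLaw_of_transferLaw`, Kernel file — sorry-free; its only non-formal ingredient `hex`
«every `ψ_W` has a least and a greatest real root» is discharged by the typer's `exists_isLeast_isGreatest` (R183f), so `companionLaw_of_transferLaw'` is unconditional
glue `TwoSelmerRankTransferLawAtTwo → TwoSelmerCompanionLawAtTwo`); third engine 5 067/5 067; not a separate obligation.  REF2-PLACEMENT v48 §9.1: PRINT-ASSEMBLY,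
theorem-grade (= v48 §3.6 P1/P2: if `β` keeps the least root ALL local Kummer conditions agree and `Sel₂(E) = β_* Sel₂(E′)` as subgroups, [cite: Cesnavicius2016SelmerFlat, Thm. 1.1(a)(b)]
+ (E1) + [cite: PoonenRains2012, Prop. 4.12]); [cite: MazurRubin2015SelmerCompanions, Thm. 3.1] void here (`p = 2`, good reduction at 2) — neighbour, not support;
beyond-print theorem: no. -/
@[conjecture] def TwoSelmerCompanionLawAtTwo : Prop :=
  ∀ {N : ℕ} [NeZero N] (W W' : WeierstrassCurve ℚ) (f f' : CuspForm (Gamma0 N) 2),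
    Odd N → W.IsElliptic → W'.IsElliptic → IsNewformOf W f → IsNewformOf W' f' →
    Irreducible W.twoTorsionPolynomial.toPoly → Irreducible W'.twoTorsionPolynomial.toPoly →
    ¬ IsSquare W.Δ → ¬ TwoTorsionSplitAtTwo W →
    Odd W.tamagawaProduct → Odd W'.tamagawaProduct →
    ∀ g : Polynomial ℚ, CarriesTwoTorsion W W' g →
    (∀ x₁ : ℝ, IsLeastTwoTorsionRoot W x₁ → IsLeastTwoTorsionRoot W' (evalReal g x₁)) →
      selmerTwoCard W = selmerTwoCard W'

/-- **P53s♭ — THE FLAT FORM OF THE TRANSFER LAW (unifies P53s with P53f; conjecture).**  The `2`-adic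
hypothesis the mechanism needs is not «off the Kilford stratum» but «`β` extends over `ℤ₂`», i.e.
`MapsConnectedTwoTorsionRootAtTwo W W' g` (automatic off the stratum: a supersingular `ψ_W` has no `ℚ₂`-root and
an ordinary non-split one has exactly the connected root rational; inside the stratum it is P53f's sharing
criterion).  Then (a)/(b) of P53s hold on EVERY stratum.  Census (N < 5·10⁵, Tam-odd, `(rank, #Ш_an ∈ {odd,4})`,
flat compatibility from the second engine's exact 2-adic root match): the 35 485 off-Kilford pairs of P53s plus,
INSIDE the stratum, the flat-compatible pairs: `Δ<0` 2165/2165, `id` 260/260, `(e₂e₃)` 77/77, `(e₁e₂)` 88/88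
equal, `(e₁e₃)` 538/538 and 3-cycles 146/146 with `|Δs₂| = 1` — 3 274/3 274, total 38 759 pairs, 0 exceptions;
the flat-INcompatible Kilford pairs break it as they must and sharply: outer order kept ⟹ `|Δs₂| ∈ {0,1}`
(1115/3603, never 2 — forced when only `v = 2` differs (`Δ<0`, `id`, `(e₂e₃)`), an extra regularity for the
egg-swap `(e₁e₂)`: 104/217/0), outer order reversed ⟹ `|Δs₂| ∈ {0,1,2}` (659/204/246: places `2` and `∞`).  Why it might fail: as P53s, plus: inside the stratum the local condition at `2` is a flat cohomology
group that `β` might respect on points but not on Kummer images (`𝓔[2] ≅ μ₂ × ℤ/2` has automorphisms beyond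
root data when `E(ℚ₂)[2]` is full).  (-imc's tag — conjecture: MEMO-imc §10.96-add4.)
REF1-AUDIT §183: **SURVIVES, theorem-grade mod L53** (with P53s/P53↻/P53½/P53∞ ONE theorem); `MapsConnectedTwoTorsionRootAtTwo` is the right hypothesis and is
vacuous-true off the Kilford stratum for the right reasons (supersingular ⟹ no `ℚ₂`-root; ordinary non-split ⟹ the unique `ℚ₂`-root is the connected one, vacuously
isolated; Kilford ⟹ the isolated root exists and is unique on any model — minimal model: `v(x₀) < 0 ≤ v(x_y − x_z) − 1`); on `C₃` pairs at most ONE of the three carriers is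
flat (3-cycles move the connected root), so the `∀ g` is consistent there and `¬ IsSquare` may stay or go (R183d); third engine: off-Kilford 7 202/7 202 + Kilford-flat
**304/304** (`Δ<0` 208, `id` 18, `(e₂e₃)` 10, `(e₁e₂)` 9 ×0; `(e₁e₃)` −1: 29 / +1: 15; cycles −1: 10/10, +1: 5/5); dropping `MapsConnected` kills it (Kilford-NONflat cycle
pairs with `Δs₂ = 0`: 24 + 26); rider R183b: for flat-INcompatible Kilford pairs step (iii) fails at `v = 2` (`L₂ ≠ β^*L′₂`, `d₂ = 1`), parity is NOT transported (`Δs₂ = +1`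
occurs 7× on `e₁↦e₂′` cycles), and -imc's «`(e₁e₂)`-nonflat never 2» (14/8/11/0 here, 104/217/0 -imc) is an OPEN regularity NOT forced by the window argument — type it
(P53♮) if conjectured.  REF2-PLACEMENT v49 §2.3: = v48 §3.3–3.4 + §2.1/§2.2: **PRINT-ASSEMBLY, theorem-grade, NOT IN PRINT as a statement; VARIANT → NEW-COMBINATION**
(the archimedean Selmer line `T_I` — `F1Sign2/ArchimedeanSelmerLineAtTwo.lean` — as the transported signed object is the unprinted joined object); the 2-adic input is
[cite: Cesnavicius2016SelmerFlat, Example (2-ss-eg), Remark (wo-ii)] at supersingular 2 and (E1) + «β flat» at ordinary 2 (`E[2]|_{G_{ℚ₂}}` alone does NOT determine the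
finite flat model at `p = 2` — the `e = p − 1` ambiguity `ℤ/2 ↔ μ₂`; what pins it is WHICH LINE is connected, i.e. P53f's bit); REF2 prediction P4 (v49 §2.4, unaudited):
on the kept-order flat-incompatible stratum `|Δs₂| ≤ 1` always («never 2» = `codim₂ = 1`, nothing deeper) with a four-way sign rule from the local theta-discrepancy
class `ū`; beyond-print theorem: no. -/
@[conjecture] def TwoSelmerRankTransferLawFlatAtTwo : Prop :=
  ∀ {N : ℕ} [NeZero N] (W W' : WeierstrassCurve ℚ) (f f' : CuspForm (Gamma0 N) 2),
    Odd N → W.IsElliptic → W'.IsElliptic → IsNewformOf W f → IsNewformOf W' f' →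
    Irreducible W.twoTorsionPolynomial.toPoly → Irreducible W'.twoTorsionPolynomial.toPoly →
    ¬ IsSquare W.Δ → Odd W.tamagawaProduct → Odd W'.tamagawaProduct →
    ∀ g : Polynomial ℚ, CarriesTwoTorsion W W' g → MapsConnectedTwoTorsionRootAtTwo W W' g →
    ∀ x₁ x₃ : ℝ, IsLeastTwoTorsionRoot W x₁ → IsGreatestTwoTorsionRoot W x₃ →
      (evalReal g x₁ ≤ evalReal g x₃ → selmerTwoCard W = selmerTwoCard W') ∧
      (evalReal g x₃ < evalReal g x₁ →
        selmerTwoCard W' = 2 * selmerTwoCard W ∨ selmerTwoCard W = 2 * selmerTwoCard W')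

/-- **P53s≤ — THE BOUND LAW (theorem-candidate; Kramer-type comparison of two Selmer structures on the common
`H¹(ℚ, E[2])` that differ at no finite place except possibly `2`, and possibly at `∞`).**  Same odd `N`, `S₃`,
both cubics irreducible, both Tamagawa products odd, any carrier `g`: the `2`-Selmer orders differ by a factor
`≤ 4` (`|Δs₂| ≤ 2`: places `2` and `∞`), and by a factor `≤ 2` when `β_g` is flat at `2` (only `∞` can differ).
Census N < 5·10⁵ (decided Tam-odd pairs): 44 586/44 586 — flat-compatible 38 759 with `|Δs₂| ≤ 1`,
flat-incompatible 5 827 with `|Δs₂| ≤ 2` (246 attain 2, all with the outer order reversed).  Route to a proof: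
the local agreement lemma of §10.96-add3 (3) at every finite `v ≠ 2` + `#Sel_ℒ / #Sel_ℒ'  ≤ ∏_v #L_v/(L_v ∩ L'_v)`.
Why it might fail: only through the local lemma (a Tam-odd additive prime where the Kummer images differ).
(-imc's tag — conjecture: MEMO-imc §10.96-add4; Kramer 1981 (Selmer structures under change of local conditions).)
REF1-AUDIT §183: **SURVIVES**; conjunct 1 (`∣ 4·`, all framed pairs, flat or not) is **theorem-grade by the window argument WITHOUT L53(ss)**: both Selmer groups
contain `S_∩ :=` the classes in `L_v ∩ L′_v` everywhere and `Sel/S_∩ ↪ ⊕_{v ∈ {2,∞}} L_v/(L_v ∩ L′_v)` with `d₂ ≤ 1` (off-Kilford: `d₂ = 0` by flatness, or `dim L₂ = 1`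
at supersingular 2; Kilford: two `L₂ = H¹_fl(ℤ₂, μ₂ × ℤ/2)`-type conditions share the unramified plane) and `d_∞ = [β⁻¹T′₁ ≠ T₁] ≤ 1`; conjunct 2 (`∣ 2·` for flat `β`) is a
**COROLLARY of P53s♭** (glue C183b `flatBound_of_flatLaw`, Kernel file; unconditional form `flatBound_of_flatLaw'` after R183f) — not a separate obligation; `¬ IsSquare`
droppable in conjunct 1; third engine **8 098/8 098** (conj. 1) & **7 506/7 506** (conj. 2); NONflat local bound `|Δs₂| ≤ 1 + d_∞` 592/592 (25 pairs attain 2, all with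
`d_∞ = 1`: `(e₁e₃)` 11, cycles 14); the diagonal instance is trivially consistent (`bound_diagonal`).  REF2-PLACEMENT v49 §2.3: the «`∣ 2·`» clause is a **COROLLARY OF
PRINT** (window `Sel_{𝓛∩𝓛′} ⊂ · ⊂ Sel_{𝓛+𝓛′}` of the common structure, `𝓛, 𝓛′` differing only at `T = {2, ∞}`; Poitou–Tate as in [cite: MazurRubin2010, Lemma 3.2] gives
`dim Sel_{𝓛+𝓛′} − dim Sel_{𝓛∩𝓛′} = Σ_{v∈T} codim_v`, a Kramer-type inequality `|s₂(E) − s₂(E′)| ≤ codim₂ + codim_∞`); the «`∣ 4·`» clause off the flat-incompatible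
Kilford stratum likewise; ON it `h¹(ℚ₂, E[2]) = 4` and a priori `codim₂ ∈ {1, 2}` (print alone gives `∣ 8·`), so «`∣ 4·`» needs the one-line local fact `codim₂ = 1`
(`L₂ ∩ βL′₂ ≠ 0`) — REF2 has no printed sentence for it, REF1 §183 supplies the argument (shared unramified plane); kept-order `|Δs₂|` never 2 in 4 718 + 313 pairs is
exactly «`codim₂ = 1`»; beyond-print theorem: no. -/
@[conjecture] def TwoSelmerTransferBoundAtTwo : Prop :=
  ∀ {N : ℕ} [NeZero N] (W W' : WeierstrassCurve ℚ) (f f' : CuspForm (Gamma0 N) 2),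
    Odd N → W.IsElliptic → W'.IsElliptic → IsNewformOf W f → IsNewformOf W' f' →
    Irreducible W.twoTorsionPolynomial.toPoly → Irreducible W'.twoTorsionPolynomial.toPoly →
    ¬ IsSquare W.Δ → Odd W.tamagawaProduct → Odd W'.tamagawaProduct →
    ∀ g : Polynomial ℚ, CarriesTwoTorsion W W' g →
      (selmerTwoCard W ∣ 4 * selmerTwoCard W' ∧ selmerTwoCard W' ∣ 4 * selmerTwoCard W) ∧
      (MapsConnectedTwoTorsionRootAtTwo W W' g →
        selmerTwoCard W ∣ 2 * selmerTwoCard W' ∧ selmerTwoCard W' ∣ 2 * selmerTwoCard W)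

/-! ### The archimedean line (§10.96-add5): double isotropy

Off the Kilford stratum (or for a flat β) and for odd Tamagawa products all FINITE local Kummer conditions of a
congruent same-level pair coincide, so both `Sel₂(E)` and `Sel₂(E')` sit between the `∞`-strict and the
`∞`-relaxed Selmer group of the common structure; the image `I` of the relaxed group in `H¹(ℝ, E[2]) ≅ E[2]`
(for `Δ > 0`) is a LINE (Poitou–Tate) which is isotropic for the archimedean Poonen–Rains form of `E` AND, via
`β`, for that of `E'` (the Kummer images are `q_v`-isotropic at every finite place for both curves, and
`Σ_v q_v = 0` on global classes).  Zero sets `{0, (e₁,0), (e₃,0)}` and `β⁻¹{0, (e₁',0), (e₃',0)}`: whenever `β`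
does not preserve the set of outer roots the line `I` is FORCED, and with it which of the two curves has a
Selmer class alive at `∞`.  Consequences typed below; all hold without exception for `N < 5·10⁵`
(`kil/p53s_inf_test.py` a19162c07adfd063 → `p53s_inf_res.json` 79750711fe5ecf63). -/

/-- **P53↻ — CYCLE ORIENTATION LAW** (conjecture-grade as typed; theorem-candidate by double isotropy).  Under
the hypotheses of P53s♭ with `Δ_W > 0`: if the carrier sends the greatest root of `ψ_W` to the least root of
`ψ_{W'}` and the least root of `ψ_W` to the middle one (the `3`-cycle `e₁ ↦ e₂' , e₂ ↦ e₃', e₃ ↦ e₁'`), then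
`#Sel₂(E') = 2·#Sel₂(E)`; for the inverse cycle `#Sel₂(E) = 2·#Sel₂(E')`.  So in P53s(b) the DIRECTION of the
jump is decided by the orientation of the cycle (for the transposition `(e₁e₃)` it is decided by the line `I`,
not by root data).  Census N < 5·10⁵: 3 994/3 994 off-Kilford + 146/146 flat-Kilford Tam-odd pairs.
Why it might fail: only through the local agreement lemma or a same-level pair where the relaxed image `I` is
not a line (it is one by Poitou–Tate whenever `E(ℚ)[2] = 0`). (-imc's tag — conjecture: MEMO-imc §10.96-add5;
refs PoonenRains2012 §4, Kramer 1981 — keyed in the REF2 rider below.)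
REF1-AUDIT §183 (D-imc-53-R5 steps (i)–(v) audited one by one): **SURVIVES, theorem-grade mod L53** — (ii) `#S^∞/#S_∞ = 2` for `Δ > 0` correct (independently by
Greenberg–Wiles/DDT 2.19: `∏_v #L_v/#H⁰(ℚ_v,V) = 2` with the 2 from `v = 2`; «`E(ℚ)[2] = 0`» not even needed; empirical shadow: `(e₁e₃)` pairs have `|Δs₂| = 1` in
1 110/1 110 + 44/44, never 0), (iii) double isotropy correct with NO compatibility between `q_∞(E)` and `q_∞(E′)` needed (only the `𝔽₂²` lemma `anisotropic_sum_of_isotropic`: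
two distinct non-zero isotropic vectors of ANY quadratic refinement of the Weil pairing have anisotropic sum, so `I` has order `≤ 2`), **(iv) PROVED** (zero set of `q_∞` =
`{0, T₁, T₃}`, the middle-root class is THE anisotropic vector; `prForm_zero_set_eq_outer_roots`, Kernel file; cite «REF1 §183 (iv)» instead of «add2 zero-set
computation»), (v) all six cases re-derived (`u ∈ {T₁,T₃} ∩ β⁻¹{T′₁,T′₃}`; cycle `e₁↦e₂′`: `u = T₃`, `#Sel₂(E′) = 2·#Sel₂(E)`, `E` dead at `∞`; inverse: mirror);
hypothesis patterns read correctly — conjunct 1 ⟺ the cycle `e₁↦e₂′, e₂↦e₃′, e₃↦e₁′`, conjunct 2 ⟺ its inverse (`evalReal_mem_realTwoTorsionRoots_of_carries` +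
injectivity on roots); `Δ_{W′} > 0` automatic (same `G_ℝ`-module); third engine **P53↻ 955/955** (cycle `e₁↦e₂′` ⟹ `Δs₂ = −1`: 512/512; inverse `+1`: 443/443 =
R183a independently); R183e: the alive-transport law `βu_W = u_{W′}` (the single statement behind P53s/P53↻/P53½/P53∞, honest carrier = D-53-∞ `archSelmerLineAtTwo`,
`F1Sign2/ArchimedeanSelmerLineAtTwo.lean`) has **0 violations in 3 723** framed flat `Δ>0` pairs (`id`: both alive 401 / both dead 274 / mixed 0; `(e₁e₃)`: exactly one alive
1 061/1 061).  REF2-PLACEMENT v49 §2.1/§2.2: (ii) **IN PRINT verbatim** [cite: MazurRubin2010, Lemma 3.2] (`T = {∞}`; `dim H¹_f(ℝ, E[2]) = 1` iff `Δ > 0`), (iii) **IN PRINT**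
[cite: PoonenRains2012, Prop. 4.10, Thm. 4.13(a)] (`k_v` archimedean allowed: `W ≅ A(k_v)/λA(k_v)` modulo the identity component is maximal isotropic; the images of
`H¹(k, A[λ])` and of `∏_v W_v` are maximal isotropic for `Q = Σ_v q_v`), (iv) **NOT LOCATED IN PRINT** — PR12 compute no archimedean `q_v` (their Remark 4.11 / Prop. 4.12 are
nonarchimedean); searched «Poonen Rains quadratic form real place», «theta characteristic real elliptic curve quadratic refinement» (corpus), «q_v archimedean|real place
quadratic form Selmer» (galaxy): 0 — a three-line computation = REF1's item, now proved; (i) = L53 (header; supersingular clause IN PRINT, v49 §2.2′); so the statements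
P53↻ / P53½ / P53∞ are **NOT IN PRINT** while every proof input is — «the cell's cleanest provable-now-not-printed candidate»; beyond-print theorem: no; PARTITION none. -/
@[conjecture] def TwoSelmerCycleOrientationLawAtTwo : Prop :=
  ∀ {N : ℕ} [NeZero N] (W W' : WeierstrassCurve ℚ) (f f' : CuspForm (Gamma0 N) 2),
    Odd N → W.IsElliptic → W'.IsElliptic → IsNewformOf W f → IsNewformOf W' f' →
    Irreducible W.twoTorsionPolynomial.toPoly → Irreducible W'.twoTorsionPolynomial.toPoly →
    ¬ IsSquare W.Δ → 0 < W.Δ → Odd W.tamagawaProduct → Odd W'.tamagawaProduct →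
    ∀ g : Polynomial ℚ, CarriesTwoTorsion W W' g → MapsConnectedTwoTorsionRootAtTwo W W' g →
    ∀ x₁ x₃ : ℝ, IsLeastTwoTorsionRoot W x₁ → IsGreatestTwoTorsionRoot W x₃ →
      (IsLeastTwoTorsionRoot W' (evalReal g x₃) → ¬ IsGreatestTwoTorsionRoot W' (evalReal g x₁) →
        selmerTwoCard W' = 2 * selmerTwoCard W) ∧
      (IsGreatestTwoTorsionRoot W' (evalReal g x₁) → ¬ IsLeastTwoTorsionRoot W' (evalReal g x₃) →
        selmerTwoCard W = 2 * selmerTwoCard W')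

/-- **P53½ — THE INNER-SWAP LAW** (theorem-candidate by double isotropy).  Under the hypotheses of P53s♭ with
`Δ_W > 0`: if the carrier fixes the least root and swaps the other two (`β = (e₂e₃)`), then the line `I` is
forced to be `⟨(e₁,0)⟩ = ⟨T♮⟩`, both Selmer groups contain a class alive at `∞`, and in particular BOTH
`2`-Selmer groups are non-trivial: `2 ∣ #Sel₂(E)` and `2 ∣ #Sel₂(E')` (a rank-`0` member of such a pair has
`Ш[2] ≠ 0`).  Census N < 5·10⁵: 3 911/3 911 curve-instances (`s₂ ≥ 1`), and «a generator on the egg or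
`Ш[2] ≠ 0`» 3 911/3 911 (63 undecided).  Why it might fail: as P53↻.
(-imc's tag — conjecture: MEMO-imc §10.96-add5.)
REF1-AUDIT §183: **SURVIVES, theorem-grade mod L53** (`u = T₁` forced: `I = ⟨T♮⟩`, both Selmer groups contain a class alive at `∞`); third engine **483/483** `(e₂e₃)` framed
flat pairs have `s₂ ≥ 1` on BOTH sides (473 off-Kilford + 10 Kilford-flat; undecided members have `Ш[2] ≠ 0` anyway); its honest strengthening is «both ALIVE at `∞`» =
`SelmerAliveAtInfinityAtTwo W ∧ SelmerAliveAtInfinityAtTwo W′` over -ty g16's `F1Sign2/ArchimedeanSelmerLineAtTwo.lean` (D-53-∞); as typed (`2 ∣ #Sel₂` twice) it is the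
decidable shadow — fine.  Hypothesis mutation (REF1 A-checks): dropping `0 < W.Δ` makes P53↻/P53½/P53∞ vacuous (`x₁ = x₃` and the hypothesis patterns contradict each other) —
load-bearing as a frame, not as content.  REF2-PLACEMENT v49 §2: as P53↻ — statement NOT IN PRINT, proof inputs [cite: MazurRubin2010, Lemma 3.2] +
[cite: PoonenRains2012, Prop. 4.10, Thm. 4.13(a)] + REF1 §183 (iv) + L53; no printed name exists for the archimedean line `T_I` (searched «archimedean Selmer condition line real
place 2-Selmer congruent curves», galaxy «Selmer at infinity|real place Selmer|archimedean Selmer»: 0); beyond-print theorem: no. -/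
@[conjecture] def TwoSelmerInnerSwapLawAtTwo : Prop :=
  ∀ {N : ℕ} [NeZero N] (W W' : WeierstrassCurve ℚ) (f f' : CuspForm (Gamma0 N) 2),
    Odd N → W.IsElliptic → W'.IsElliptic → IsNewformOf W f → IsNewformOf W' f' →
    Irreducible W.twoTorsionPolynomial.toPoly → Irreducible W'.twoTorsionPolynomial.toPoly →
    ¬ IsSquare W.Δ → 0 < W.Δ → Odd W.tamagawaProduct → Odd W'.tamagawaProduct →
    ∀ g : Polynomial ℚ, CarriesTwoTorsion W W' g → MapsConnectedTwoTorsionRootAtTwo W W' g →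
    ∀ x₁ x₃ : ℝ, IsLeastTwoTorsionRoot W x₁ → IsGreatestTwoTorsionRoot W x₃ →
      IsLeastTwoTorsionRoot W' (evalReal g x₁) → ¬ IsGreatestTwoTorsionRoot W' (evalReal g x₃) →
        2 ∣ selmerTwoCard W ∧ 2 ∣ selmerTwoCard W'

/-- **P53∞ — THE IDENTITY-COMPONENT LAW** (theorem-candidate by double isotropy; the Mordell–Weil shadow of
«every Selmer class of `E` is trivial at `∞`»).  Under the hypotheses of P53s♭ with `Δ_W > 0`: if the carrier
sends the least root of `ψ_W` (the egg point `T♮`) to the MIDDLE root of `ψ_{W'}` (`β = (e₁e₂)` or the cycle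
`e₁ ↦ e₂'`), then the line `I` is `⟨(e₃,0)⟩`, no Selmer class of `E` survives at `∞`, hence EVERY rational
point of `E` lies on the identity real component: `x(P) > e₃` for all affine `P ∈ E(ℚ)`.  Census N < 5·10⁵
(Cremona generators): `(e₁e₂)` pairs 3 036/3 036 curve-instances (both members), `3`-cycles 4 213/4 213
(the member so oriented), and the `(e₁e₃)` analogue (the member with the smaller Selmer group) 6 595/6 595 —
no generator on an egg.  Why it might fail: as P53↻ (the statement is about all of `E(ℚ)`, tested on
generators, which suffices since `E(ℚ) → E(ℝ)/E(ℝ)⁰` is a homomorphism killed by odd torsion).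
(-imc's tag — conjecture: MEMO-imc §10.96-add5.)
REF1-AUDIT §183: **SURVIVES, theorem-grade mod L53** (`u = T₃` forced in BOTH hypothesis patterns — `β = (e₁e₂)` and the cycle `e₁ ↦ e₂′`; «dead at `∞`» ⟹
`E(ℚ)/2E(ℚ) → E(ℝ)/E⁰(ℝ)` is zero ⟹ every rational point on the identity component, `2E(ℝ) = E⁰(ℝ)` for `Δ > 0`); readback A1: `x₃ < (x : ℝ)` reads «`P` on the identity
real component» correctly for a GENERAL Weierstrass model (`(y + (a₁x + a₃)/2)² = ψ_W(x)/4`, unbounded component = `x ≥ e₃`, `x = e₃` excluded by irreducibility), and the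
conclusion quantifies over ALL affine rational points of the model `W`; non-vacuity ✓ (rank `≥ 1` members abound), junk ✓; third engine (Cremona generators from
`allgens`, exact Sturm count for «on the egg»): **0 egg generators in 2 783 constrained curve-instances (843 generators tested)** — `(e₁e₂)` both members 330 + 330
instances, cycle-oriented member 513 + 456, `(e₁e₃)` smaller-Selmer member 1 154 — against ≈ 90 % egg generators in the unconstrained CONTROLS (463/513, 415/456,
1 062/1 154, `(e₂e₃)` 412/483 & 426/483, `id` 429/780 & 462/780): the prediction bites.  REF2-PLACEMENT v49 §2.1 (note for -ty): PR12's `W` at an archimedean place is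
`A(k_v)/λA(k_v)` modulo the identity component's image — for `E/ℝ` with `Δ > 0` this is `E(ℝ)/2E(ℝ) ≅ E(ℝ)/E(ℝ)⁰ = ⟨class of the egg⟩`
[cite: PoonenRains2012, Prop. 4.10], consistent with -imc's `T_I ∈ {T♮, T♭}` bookkeeping; the real 2-torsion / real-component dictionary is [cite: SilvermanAEC2009, VI.5 and C.11];
statement NOT IN PRINT, proof inputs printed (as P53↻); beyond-print theorem: no; PARTITION none; BSD not proved. -/
@[conjecture] def RealIdentityComponentLawAtTwo : Prop :=
  ∀ {N : ℕ} [NeZero N] (W W' : WeierstrassCurve ℚ) (f f' : CuspForm (Gamma0 N) 2),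
    Odd N → W.IsElliptic → W'.IsElliptic → IsNewformOf W f → IsNewformOf W' f' →
    Irreducible W.twoTorsionPolynomial.toPoly → Irreducible W'.twoTorsionPolynomial.toPoly →
    ¬ IsSquare W.Δ → 0 < W.Δ → Odd W.tamagawaProduct → Odd W'.tamagawaProduct →
    ∀ g : Polynomial ℚ, CarriesTwoTorsion W W' g → MapsConnectedTwoTorsionRootAtTwo W W' g →
    ∀ x₁ x₃ : ℝ, IsLeastTwoTorsionRoot W x₁ → IsGreatestTwoTorsionRoot W x₃ →
      ¬ IsLeastTwoTorsionRoot W' (evalReal g x₁) → ¬ IsGreatestTwoTorsionRoot W' (evalReal g x₁) →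
        ∀ x y : ℚ, W.toAffine.Equation x y → x₃ < (x : ℝ)

end Summit.BirchSwinnertonDyer.Rank1Residual.F1Sign2

end
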